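import Summits.QuantumFields.YangMills.Theorems.PoincareLipschitzHistoryTailOfLinearTail
import Summits.QuantumFields.YangMills.Theorems.PoincareLipschitzTwoSidedOfConcentrationBudget

/-!
# Crux `HistoryTailL` (stmt-QuantumFields-19936) — FILE K-18b: THE p-LINEAR GLUE WITH THE FREE TOP FRACTION THREADED THROUGH
# (`HistoryTailL` ⟸ per-plaquette finest-bad-level tails at the CONSTRAINED heights `j + ⌊(K−1)∕m⌋ ≤ K` only, constants AFTER `m`; LEAD seat ym-ust-19936-w1 g11)

Cell `ym3-torus` (YM ladder rung R3 = continuum SU(2) Yang–Mills on T³ — a RUNG, NOT the Clay problem: not d = 4, not infinite volume, not a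
mass gap).  Helper `--supports stmt-QuantumFields-19936`; THEOREMS ONLY, def-free.

WHY.  `T3UnitScaleTilt.HistoryTailAt F γ b₀ p₀ m` bounds the Gibbs masses of `(histGood K ⌊K∕m⌋)ᶜ` (run `K`) and `(histGood (K+1) ⌊K∕m⌋)ᶜ`
(run `K+1`); the event `histGood K' n` constrains the averaged heights `j ≤ K' − n` ONLY.  So the finest-bad-level reduction
✓`HistoryTailOfTwoSided.historyTailAt_of_bare_finestBad` (which asks for the per-height bound at EVERY `1 ≤ j`, `j + 2 ≤ K`) over-asks: per `m`
only the heights with `j + ⌊(K'−1)∕m⌋ ≤ K'` are read (`⌊(K'−1)∕m⌋ ≤ ⌊K∕m⌋` for both runs).  And since in `UnitScaleTilt.HistoryTailL` the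
coupling threshold `γ₁` is chosen AFTER `m` while the profile `(b₀, p₀)` is chosen before, per-height constants `C, c` may depend on `m`
provided no threshold `bmin ≤ b₀` is needed — which the exponent `p₀ > 2` buys: for `γ ≤ e^{−2b'∕b₀}` one has
`p_{b₀,p₀}(g_h) ≥ p_{b',p₀−1}(g_h)` at every height (`pFun_substitute_le`), so the landed p-linear arithmetic
✓`PoincareLipschitzHistoryTailOfLinearTail.perHeight_bound_lin` runs at the SUBSTITUTE profile `(b' := 8∕c, p₀ − 1)` with its threshold
`2·4 ≤ c·b'` met by definition.

WHAT IS PROVED (ns `…Theorems.PoincareLipschitzHistoryTailOfLinearTailDeep`).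
* `pFun_substitute_le` — `B10.pFun b' (p₀ − 1) (g_h) ≤ B10.pFun b₀ p₀ (g_h)` for `γ ≤ e^{−2(b'∕b₀)}`, `0 < γ ≤ 1`, `b₀ > 0` (any real `b'`);
  `exp_neg_pFun_substitute_le` ∕ `exp_neg_pFun_sq_substitute_le` — the two monotone consequences used by the K2 lane.
* `historyTailAt_of_bare_finestBad_deep` — ✓`historyTailAt_of_bare_finestBad` VERBATIM with the per-height hypothesis `hfb` asked only for
  `j + ⌊(K−1)∕m⌋ ≤ K` (one extra binder; the run bound `hrun` carries `⌊(K−1)∕m⌋ ≤ n`; two `omega`s and two one-line `Nat` facts more).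
* ★★ `historyTailL_of_linearTail_deep (hT) : UnitScaleTilt.HistoryTailL` — from the p-linear per-plaquette finest-bad-level tail asked, FOR EACH
  `m > 0` (constants `C, c` after `m`, no `bmin`), only at heights `1 ≤ j`, `j + 2 ≤ K`, `j + ⌊(K−1)∕m⌋ ≤ K`; profile `b₀ = max b₁ 1`,
  `p₀ = max p₁ 3`; bare term ✓`T3BareTailProfile.bareTailAt`; per height ✓`perHeight_bound_lin` at the substitute profile.
HONEST: route glue (bookkeeping); `hT` is OPEN; nothing of K1 ∕ K2 ∕ (Q), the cruxes, rung R3 or the mass gap is proved here.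
[adapted from ✓`FibreConvexityTailHistoryTailOfTwoSided.historyTailAt_of_bare_finestBad` (the route-FibreConvexityTail glue seat) and
✓`PoincareLipschitzHistoryTailOfLinearTail.historyTailL_of_linearTail` (ym-ust-19936-w4 g12); credits there.]
References: T. Bałaban, CMP 102 (1985) 255–275 [Balaban1985UV3] ((7) p.257, (71) p.273).
-/

set_option autoImplicit false

noncomputable section

open MeasureTheory Filter Topology
open Literature.MathematicalPhysics.QuantumFieldTheory.Balaban1983to89
open Literature.MathematicalPhysics.QuantumFieldTheory.Balaban1983to89.Missing
open Literature.MathematicalPhysics.QuantumFieldTheory.Balaban1983to89.T4Continuum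
open Literature.MathematicalPhysics.QuantumFieldTheory.Balaban1983to89.T3ContinuumYM3Torus
open Literature.MathematicalPhysics.QuantumFieldTheory.Balaban1983to89.T3UnitScaleTilt
open Literature.MathematicalPhysics.QuantumFieldTheory.Balaban1983to89.T3UnitLawDensityEML (ℰp measurableE_ℰp)
open Literature.MathematicalPhysics.QuantumFieldTheory.Balaban1983to89.T3HistoryTailReduction
open Literature.MathematicalPhysics.QuantumFieldTheory.Balaban1983to89.T3BareTailProfile
open Summit.QuantumFields.YangMills.Theorems.HistoryTailOfTwoSided
open Summit.QuantumFields.YangMills.Theorems.PoincareLipschitzHistoryTailOfLinearTail (perHeight_bound_lin real_not_plaqSmall_inter_le_sum)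
open Summit.QuantumFields.YangMills.Theorems.PoincareLipschitz.TwoSidedOfConcentration (coupling_basic log_inv_coupling_ge)

namespace Summit.QuantumFields.YangMills.Theorems.PoincareLipschitzHistoryTailOfLinearTailDeep

/-! ## §1 The substitute profile: `p_{b₀,p₀} ≥ p_{b',p₀−1}` once `log γ⁻¹ ≥ 2b'∕b₀` -/

/-- **SUBSTITUTE PROFILE.**  For `L ≥ 1`, `0 < γ ≤ 1`, `b₀ > 0`, any `b'` and `γ ≤ e^{−2(b'∕b₀)}`: at every height `h`,
`p_{b',p₀−1}(g_h) ≤ p_{b₀,p₀}(g_h)` where `g_h = √(γL^{−h})`, `p_{b,p}(g) = b(1 + log g⁻¹)^p` — since `u := 1 + log g_h⁻¹ ≥ log g_h⁻¹ ≥ b'∕b₀`,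
`b'·u^{p₀−1} ≤ (b₀u)·u^{p₀−1} = b₀u^{p₀}`.  [cite: Balaban1985UV3, (7) p.257] -/
theorem pFun_substitute_le {L : ℕ} (hL : 1 ≤ L) {γ b₀ b' : ℝ} (p₀ : ℝ) (hγ : 0 < γ) (hγ1 : γ ≤ 1) (hb₀ : 0 < b₀)
    (hγs : γ ≤ Real.exp (-(2 * (b' / b₀)))) (h : ℕ) :
    B10.pFun b' (p₀ - 1) (Real.sqrt (γ * ((L : ℝ)⁻¹) ^ h)) ≤ B10.pFun b₀ p₀ (Real.sqrt (γ * ((L : ℝ)⁻¹) ^ h)) := by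
  obtain ⟨hg, hg1, -, -⟩ := coupling_basic hL hγ hγ1 h
  have hX := log_inv_coupling_ge hL hγ hγ1 hγs h
  set g := Real.sqrt (γ * ((L : ℝ)⁻¹) ^ h) with hgdef
  have hlog : 0 ≤ Real.log g⁻¹ := Real.log_nonneg ((one_le_inv₀ hg).mpr hg1)
  set u : ℝ := 1 + Real.log g⁻¹ with hu
  have hu0 : 0 < u := by rw [hu]; linarith
  have hbu : b' ≤ b₀ * u := by
    calc b' = b₀ * (b' / b₀) := by field_simp
      _ ≤ b₀ * Real.log g⁻¹ := mul_le_mul_of_nonneg_left hX hb₀.le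
      _ ≤ b₀ * u := mul_le_mul_of_nonneg_left (by rw [hu]; linarith) hb₀.le
  show b' * u ^ (p₀ - 1) ≤ b₀ * u ^ p₀
  have hsplit : u ^ p₀ = u ^ (p₀ - 1) * u := by
    rw [Real.rpow_sub_one hu0.ne']; field_simp
  calc b' * u ^ (p₀ - 1) ≤ (b₀ * u) * u ^ (p₀ - 1) := mul_le_mul_of_nonneg_right hbu (Real.rpow_nonneg hu0.le _)
    _ = b₀ * u ^ p₀ := by rw [hsplit]; ring

/-- The p-linear exponential at the substitute profile dominates: `e^{−c·p_{b₀,p₀}(g_h)} ≤ e^{−c·p_{b',p₀−1}(g_h)}` (`c > 0`).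
[cite: Balaban1985UV3, (7) p.257] -/
theorem exp_neg_pFun_substitute_le {L : ℕ} (hL : 1 ≤ L) {γ b₀ b' c : ℝ} (p₀ : ℝ) (hγ : 0 < γ) (hγ1 : γ ≤ 1) (hb₀ : 0 < b₀)
    (hc : 0 < c) (hγs : γ ≤ Real.exp (-(2 * (b' / b₀)))) (h : ℕ) :
    Real.exp (-(c * B10.pFun b₀ p₀ (Real.sqrt (γ * ((L : ℝ)⁻¹) ^ h)))) ≤
      Real.exp (-(c * B10.pFun b' (p₀ - 1) (Real.sqrt (γ * ((L : ℝ)⁻¹) ^ h)))) := by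
  have h1 := pFun_substitute_le hL p₀ hγ hγ1 hb₀ hγs h
  exact Real.exp_le_exp.mpr (by nlinarith)

/-- The quadratic (level-0) exponential at the substitute profile dominates: `e^{−c·p_{b₀,p₀}(g_h)²} ≤ e^{−c·p_{b',p₀−1}(g_h)²}` (`c > 0`).
[cite: Balaban1985UV3, (7) p.257] -/
theorem exp_neg_pFun_sq_substitute_le {L : ℕ} (hL : 1 ≤ L) {γ b₀ b' c : ℝ} (p₀ : ℝ) (hγ : 0 < γ) (hγ1 : γ ≤ 1) (hb₀ : 0 < b₀)
    (hb' : 0 ≤ b') (hc : 0 < c) (hγs : γ ≤ Real.exp (-(2 * (b' / b₀)))) (h : ℕ) :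
    Real.exp (-(c * B10.pFun b₀ p₀ (Real.sqrt (γ * ((L : ℝ)⁻¹) ^ h)) ^ 2)) ≤
      Real.exp (-(c * B10.pFun b' (p₀ - 1) (Real.sqrt (γ * ((L : ℝ)⁻¹) ^ h)) ^ 2)) := by
  obtain ⟨hg, hg1, -, -⟩ := coupling_basic hL hγ hγ1 h
  have h1 := pFun_substitute_le hL p₀ hγ hγ1 hb₀ hγs h
  have h0 : 0 ≤ B10.pFun b' (p₀ - 1) (Real.sqrt (γ * ((L : ℝ)⁻¹) ^ h)) := B10.pFun_nonneg b' (p₀ - 1) _ hb' hg hg1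
  have h2 : B10.pFun b' (p₀ - 1) (Real.sqrt (γ * ((L : ℝ)⁻¹) ^ h)) ^ 2 ≤ B10.pFun b₀ p₀ (Real.sqrt (γ * ((L : ℝ)⁻¹) ^ h)) ^ 2 :=
    pow_le_pow_left₀ h0 h1 2
  exact Real.exp_le_exp.mpr (by nlinarith)

/-! ## §2 The reduction with the free top fraction threaded through -/

/-- **`HistoryTailAt` FROM A BARE PROFILE AND A FINEST-BAD-LEVEL PROFILE AT THE CONSTRAINED HEIGHTS ONLY** (`SU(2)`, printed smearing,
`γ ≥ 0`, `m ≥ 1`): as ✓`historyTailAt_of_bare_finestBad`, but the per-height bound `hfb` is asked only at heights `j` with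
`j + ⌊(K−1)∕m⌋ ≤ K` (besides `1 ≤ j`, `j + 2 ≤ K`) — run `K'` with `n = ⌊K∕m⌋` free top steps constrains `j ≤ K' − n` and `⌊(K'−1)∕m⌋ ≤ n`
for both `K' = K` and `K' = K + 1`.  Profile `w_K = 𝟙[K < 2m] + q₀ K + q₀ (K+1) + Σ'_t q(t + ⌊K∕m⌋)` unchanged.
[cite: Balaban1985UV3, (7) p.257 and (71) p.273] -/
theorem historyTailAt_of_bare_finestBad_deep (F : T3Family) {γ : ℝ} (hγ : 0 ≤ γ) (b₀ p₀ : ℝ) {m : ℕ} (hm : 0 < m)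
    (q₀ q : ℕ → ℝ) (hq₀0 : ∀ i, 0 ≤ q₀ i) (hq₀ : Summable q₀) (hq0 : ∀ i, 0 ≤ q i) (hq : Summable q)
    (hqt : Summable fun n => ∑' t, q (t + n))
    (hbare : ∀ K, (gibbsK F ℰp γ K).real {U | ¬ PlaqSmall (θBal F.L γ b₀ p₀ K) U} ≤ q₀ K)
    (hfb : ∀ K j, 1 ≤ j → j + 2 ≤ K → j + (K - 1) / m ≤ K → (gibbsK F ℰp γ K).real
      ({U | ¬ PlaqSmall (θBal F.L γ b₀ p₀ (K - j))
          (Averaging.iter (fun i => BlockAveraging.blockAvg (P := F.P K) (j := i) ℰp) j U)} ∩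
        {U | ∀ i, i < j → PlaqSmall (θBal F.L γ b₀ p₀ (K - i))
          (Averaging.iter (fun i' => BlockAveraging.blockAvg (P := F.P K) (j := i') ℰp) i U)}) ≤ q (K - j)) :
    HistoryTailAt F γ b₀ p₀ m := by
  classical
  have hT0 : ∀ n, 0 ≤ ∑' t, q (t + n) := fun n => tsum_nonneg fun _ => hq0 _
  -- one run `K` with `n ≥ 2` free top steps
  have hrun : ∀ K n, 2 ≤ n → (K - 1) / m ≤ n →
      (gibbsK F ℰp γ K).real (histGood F ℰp (θBal F.L γ b₀ p₀) K n)ᶜ ≤ q₀ K + ∑' t, q (t + n) := by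
    intro K n hn hmn
    haveI := isProbabilityMeasure_gibbsK F ℰp hγ K
    by_cases hnK : n ≤ K
    · refine (real_compl_histGood_le_sum_finestBad F ℰp (θBal F.L γ b₀ p₀) K n (gibbsK F ℰp γ K)).trans ?_
      rw [Finset.sum_range_succ', add_comm]
      refine add_le_add ?_ ?_
      · exact (measureReal_mono Set.inter_subset_left (measure_ne_top _ _)).trans (hbare K)
      · calc ∑ j ∈ Finset.range (K - n), (gibbsK F ℰp γ K).real
              ({U | ¬ PlaqSmall (θBal F.L γ b₀ p₀ (K - (j + 1)))
                  (Averaging.iter (fun i => BlockAveraging.blockAvg (P := F.P K) (j := i) ℰp) (j + 1) U)} ∩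
                {U | ∀ i, i < j + 1 → PlaqSmall (θBal F.L γ b₀ p₀ (K - i))
                  (Averaging.iter (fun i' => BlockAveraging.blockAvg (P := F.P K) (j := i') ℰp) i U)})
            ≤ ∑ j ∈ Finset.range (K - n), q (K - (j + 1)) :=
              Finset.sum_le_sum fun j hj => hfb K (j + 1) (by omega)
                (by have := Finset.mem_range.mp hj; omega) (by have := Finset.mem_range.mp hj; omega)
          _ = ∑ j ∈ Finset.range (K - n), q (j + n) := by
              rw [← Finset.sum_range_reflect (fun j => q (j + n)) (K - n)]
              refine Finset.sum_congr rfl fun j hj => ?_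
              have := Finset.mem_range.mp hj
              show q (K - (j + 1)) = q (K - n - 1 - j + n)
              congr 1
              omega
          _ ≤ ∑' t, q (t + n) := ((summable_nat_add_iff n).mpr hq).sum_le_tsum _ fun _ _ => hq0 _
    · rw [histGood_of_lt F ℰp (not_le.mp hnK), Set.compl_univ, measureReal_empty]
      exact add_nonneg (hq₀0 K) (hT0 n)
  -- the profile
  refine ⟨fun K => (if K < 2 * m then (1 : ℝ) else 0) + (q₀ K + q₀ (K + 1) + ∑' t, q (t + K / m)), ?_, fun K => ?_⟩
  · refine Summable.add ?_ ((hq₀.add ((summable_nat_add_iff 1).mpr hq₀)).add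
      (summable_comp_div (T := fun n => ∑' t, q (t + n)) hT0 hqt hm))
    exact summable_of_ne_finset_zero (s := Finset.range (2 * m)) fun K hK =>
      if_neg (by rwa [Finset.mem_range] at hK)
  · beta_reduce
    have hrest : 0 ≤ q₀ K + q₀ (K + 1) + ∑' t, q (t + K / m) :=
      add_nonneg (add_nonneg (hq₀0 _) (hq₀0 _)) (hT0 _)
    by_cases hK : K < 2 * m
    · rw [if_pos hK]
      haveI := isProbabilityMeasure_gibbsK F ℰp hγ K
      haveI := isProbabilityMeasure_gibbsK F ℰp hγ (K + 1)
      exact ⟨measureReal_le_one.trans (le_add_of_nonneg_right hrest),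
        measureReal_le_one.trans (le_add_of_nonneg_right hrest)⟩
    · rw [if_neg hK, zero_add]
      have hn2 : 2 ≤ K / m := (Nat.le_div_iff_mul_le hm).mpr (by omega)
      have hm1 : (K - 1) / m ≤ K / m := Nat.div_le_div_right (Nat.sub_le K 1)
      have hm2 : (K + 1 - 1) / m ≤ K / m := by rw [Nat.add_sub_cancel]
      constructor
      · exact (hrun K (K / m) hn2 hm1).trans (by linarith [hq₀0 (K + 1)])
      · exact (hrun (K + 1) (K / m) hn2 hm2).trans (by linarith [hq₀0 K])

/-! ## §3 The knit: `HistoryTailL` from the p-linear tail at the constrained heights, constants after `m` -/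

/-- ★★ **`UnitScaleTilt.HistoryTailL` FROM THE p-LINEAR PER-PLAQUETTE TAIL AT THE CONSTRAINED HEIGHTS, CONSTANTS AFTER `m`.**  The
hypothesis `hT` asks, for every `L` and every `m > 0`, for `C ≥ 0`, `c > 0` (NO threshold on `b₀`) such that for all `b₀ > 0`, `p₀ > 2` some
`γ₁ ∈ (0,1]` gives `Gibbs_K({θ(K−j) ≤ dist1 Ū^{j}(∂a)} ∩ {∀ i < j, PlaqSmall θ(K−i) Ū^{i}}) ≤ C·e^{−c·p(g_{K−j})}` at the heights `1 ≤ j`,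
`j + 2 ≤ K`, `j + ⌊(K−1)∕m⌋ ≤ K` only.  Proof: profile `(max b₁ 1, max p₁ 3)` fixed before `m`; given `m`, the substitute profile
`(8∕c, p₀ − 1)` carries ✓`perHeight_bound_lin` (threshold `8 ≤ c·(8∕c)`), valid once `γ ≤ e^{−2(8∕c)∕b₀}`; bare term ✓`bareTailAt`; then
`historyTailAt_of_bare_finestBad_deep`.  [cite: Balaban1985UV3, (7) p.257 and (71) p.273] -/
theorem historyTailL_of_linearTail_deep
    (hT : ∀ (L m : ℕ), 0 < m → ∃ (C c : ℝ), 0 ≤ C ∧ 0 < c ∧ ∀ (b₀ p₀ : ℝ), 0 < b₀ → 2 < p₀ →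
      ∃ γ₁ : ℝ, 0 < γ₁ ∧ γ₁ ≤ 1 ∧ ∀ (F : T3Family) (γ : ℝ), F.L = L → 0 < γ → γ ≤ γ₁ →
        ∀ (K j : ℕ), 1 ≤ j → j + 2 ≤ K → j + (K - 1) / m ≤ K → ∀ a : Plaq (F.P K) j,
          (gibbsK F ℰp γ K).real
              ({U : GaugeField (F.P K) 0 (Matrix.specialUnitaryGroup (Fin 2) ℂ) |
                  θBal F.L γ b₀ p₀ (K - j) ≤ GaugeGroup.dist1 (GaugeField.plaqHol
                    (Averaging.iter (fun i' => BlockAveraging.blockAvg (P := F.P K) (j := i') ℰp) j U) a)} ∩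
                {U : GaugeField (F.P K) 0 (Matrix.specialUnitaryGroup (Fin 2) ℂ) | ∀ i, i < j →
                  PlaqSmall (θBal F.L γ b₀ p₀ (K - i))
                    (Averaging.iter (fun i' => BlockAveraging.blockAvg (P := F.P K) (j := i') ℰp) i U)}) ≤
            C * Real.exp (-(c * B10.pFun b₀ p₀ (Real.sqrt (γ * ((F.L : ℝ)⁻¹) ^ (K - j)))))) :
    Summit.QuantumFields.YangMills.Theses.UnitScaleTilt.HistoryTailL := by
  intro L b₁ p₁
  -- the profile above the floor, fixed BEFORE `m`
  obtain ⟨b₀, hb₁, hb₀1⟩ : ∃ b₀ : ℝ, b₁ ≤ b₀ ∧ 1 ≤ b₀ := ⟨max b₁ 1, le_max_left _ _, le_max_right _ _⟩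
  obtain ⟨p₀, hp₁, hp₀⟩ : ∃ p₀ : ℝ, p₁ ≤ p₀ ∧ 2 < p₀ :=
    ⟨max p₁ 3, le_max_left _ _, lt_of_lt_of_le (by norm_num) (le_max_right _ _)⟩
  have hb₀ : 0 < b₀ := one_pos.trans_le hb₀1
  have hp₀1 : 1 ≤ p₀ := by linarith
  have hp₀' : 1 ≤ p₀ - 1 := by linarith
  refine ⟨b₀, p₀, hb₁, hp₁, hb₀, hp₀, fun m hm => ?_⟩
  -- the constants AFTER `m`, and the substitute amplitude `b' = 8/c`
  obtain ⟨C, c, hC, hc, H⟩ := hT L m hm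
  obtain ⟨γ₁, hγ₁, hγ₁1, HF⟩ := H b₀ p₀ hb₀ hp₀
  set b' : ℝ := 8 / c with hb'
  have hb'0 : 0 < b' := by positivity
  have hcb : 2 * (((0 : ℕ) : ℝ) + 4) ≤ c * b' := by
    rw [hb', mul_div_cancel₀ _ hc.ne']; push_cast; norm_num
  set γs : ℝ := Real.exp (-(2 * (b' / b₀))) with hγs
  have hγs0 : 0 < γs := Real.exp_pos _
  refine ⟨min γ₁ γs, lt_min hγ₁ hγs0, fun F γ hFL hγ hγle => ?_⟩
  have hγle₁ : γ ≤ γ₁ := hγle.trans (min_le_left _ _)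
  have hγleS : γ ≤ γs := hγle.trans (min_le_right _ _)
  have hγ1 : γ ≤ 1 := hγle₁.trans hγ₁1
  have hL1 : 1 ≤ F.L := F.hL.2.le
  -- the bare profile (landed: reflection positivity + chessboard) and the per-height constant at the substitute profile
  obtain ⟨q₀, hq₀0, hq₀, -, hbare⟩ := bareTailAt F hγ hγ1 hb₀ hp₀1
  set A' : ℝ := 72 * C * (F.L : ℝ) ^ (3 * F.m) * γ⁻¹ ^ (0 : ℕ) with hA'
  have hA'0 : 0 ≤ A' := by positivity
  obtain ⟨hq0, hq, hqt⟩ := geometric_profile hA'0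
  refine historyTailAt_of_bare_finestBad_deep F hγ.le b₀ p₀ hm q₀ (fun i => A' * ((1 : ℝ) / 2) ^ i)
    hq₀0 hq₀ hq0 hq hqt hbare fun K j hj1 hjK hjm => ?_
  -- one height: union over plaquettes, the p-linear tail, the substitute profile, the count, the arithmetic
  haveI := isProbabilityMeasure_gibbsK F ℰp hγ.le K
  refine (real_not_plaqSmall_inter_le_sum (gibbsK F ℰp γ K)
    (Averaging.iter (fun i' => BlockAveraging.blockAvg (P := F.P K) (j := i') ℰp) j) (θBal F.L γ b₀ p₀ (K - j))
    {U | ∀ i, i < j → PlaqSmall (θBal F.L γ b₀ p₀ (K - i))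
      (Averaging.iter (fun i' => BlockAveraging.blockAvg (P := F.P K) (j := i') ℰp) i U)}).trans ?_
  refine (Finset.sum_le_sum fun a _ => HF F γ hFL hγ hγle₁ K j hj1 hjK hjm a).trans ?_
  rw [Finset.sum_const, Finset.card_univ, nsmul_eq_mul]
  have hcard := card_plaq_le_pow F (show j ≤ K by omega)
  have hsub : C * Real.exp (-(c * B10.pFun b₀ p₀ (Real.sqrt (γ * ((F.L : ℝ)⁻¹) ^ (K - j))))) ≤
      C * Real.exp (-(c * B10.pFun b' (p₀ - 1) (Real.sqrt (γ * ((F.L : ℝ)⁻¹) ^ (K - j))))) :=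
    mul_le_mul_of_nonneg_left (hFL ▸ exp_neg_pFun_substitute_le hL1 p₀ hγ hγ1 hb₀ hc hγleS (K - j)) hC
  have hX : 0 ≤ C * Real.exp (-(c * B10.pFun b' (p₀ - 1) (Real.sqrt (γ * ((F.L : ℝ)⁻¹) ^ (K - j))))) := by positivity
  have hper := perHeight_bound_lin F hγ hγ1 hb'0 hp₀' hC 0 hc hcb (K - j)
  simp only [pow_zero, mul_one] at hper
  calc (Fintype.card (Plaq (F.P K) j) : ℝ) * (C * Real.exp (-(c * B10.pFun b₀ p₀ (Real.sqrt (γ * ((F.L : ℝ)⁻¹) ^ (K - j))))))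
      ≤ (Fintype.card (Plaq (F.P K) j) : ℝ) * (C * Real.exp (-(c * B10.pFun b' (p₀ - 1) (Real.sqrt (γ * ((F.L : ℝ)⁻¹) ^ (K - j)))))) :=
        mul_le_mul_of_nonneg_left hsub (Nat.cast_nonneg _)
    _ ≤ (9 * (8 * (F.L : ℝ) ^ (3 * F.m) * ((F.L : ℝ) ^ (K - j)) ^ 3)) *
          (C * Real.exp (-(c * B10.pFun b' (p₀ - 1) (Real.sqrt (γ * ((F.L : ℝ)⁻¹) ^ (K - j)))))) :=
        mul_le_mul_of_nonneg_right hcard hX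
    _ ≤ A' * ((1 : ℝ) / 2) ^ (K - j) := by rw [hA']; simpa only [pow_zero, mul_one] using hper

end Summit.QuantumFields.YangMills.Theorems.PoincareLipschitzHistoryTailOfLinearTailDeep

end
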